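import Mathlib
import HarnessLib
import Summits.HubbardSuperconductivity.HubbardSuperconductivity.Theorems.KLProgrammeKLRegimeEngineOverlapMeanFreePieceReg
import Summits.HubbardSuperconductivity.HubbardSuperconductivity.Theorems.KLProgrammeKLRegimeThinOverlapIncrementRowsScale
import Summits.HubbardSuperconductivity.HubbardSuperconductivity.Theorems.KLProgrammeKLRegimeSplitThermalLayer

/-!
# K3 ENGINE child (stmt-HubbardSuperconductivity-20437), stub (b) (ℓ)/(I1′) below the deep window — the W2 (OVERLAP) twin of (D5), brick (W3):
# the WEIGHTED rows and columns of ONE overlap-defect piece `E(F_{k+1}[K♯_{i+1}])·S(F̃_k[K♯_{i+1}]) − E(F_{k+1}[K♯_i])·S(F̃_k[K♯_i])` at the tree weight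
# `klScaleWt (k+1)`: `(M/β)·(Φ₁·4^{k+1}/4^i + Φ₂)·G₀`, `G₀ = (c″+Gfr₁+Gfr₂+Gfr₃+1)U²`, `Φ₁, Φ₂` ABSOLUTE

Cell `gate-hubbard-kl`, seat hubbard-kl-k3c3-p2 (g12); F1-W2-DESIGN §2 (W3).  `charSumWt_thinPairDiff_meanFree'` (W2′, registered (K5′) binder) ∘ a SHARP closed-form majorant of p3's
per-piece bound (ONE power of `1/Λ_{k+1}`: the Matsubara count `Λ_{k+1}β/π + 1 ≤ 2Λ_{k+1}β/π` under `π ≤ Λ_{k+1}β` (`klth_pi_div_le_klScale_nScales`), so that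
`(1/s₀)·(Λβ)` is `Λ`-free — p3's `thinPair_rhs_majorant` spends `(1/Λ)²`, affordable there because the `Λ_T`-weight is weak) ∘ p3's weight domination
`rowSumWt/colSumWt_klReanalysis_sub_le_of_rates` (…ThinOverlapIncrementRowsScale) with `D_w := πΘ_c + Λ_{k+1}4^i/ρ` (the tree weight's slope `Λ_{k+1}` against
the piece's rates `s₀ = Λ_{k+1}β/(MπΘ_c)`, `s₁ = ρ/4^i`), the `ε = β/2M` of `klReanalysis` divided out:

* `thinPair_rhs_majorant_sharp` — pure real arithmetic;
* **`rowColSumWt_overlap_sub_meanFree`** — `∃ Φ₁ Φ₂ > 0` (absolute) such that along every admissible history in the KL regime with the (K5′) clauses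
  (`∀ m, 1 ≤ m → m < n → FlowPieceOscAt … c″ … m` — stub (b)'s registered binder —, `0 ≤ c″`, `c″U ≤ 1`), on every lattice `V` (`klEngL₃ ≤ V`), for `2(k+1)+5 ≤ i`, `i+1 ≤ n`: the `klScaleWt (k+1)`-weighted
  rows of the piece are `≤ (M/β)·((Φ₁·4^{k+1}/4^i + Φ₂)·G₀)` and the columns `≤ 2×` that.  The x-free part `Φ₂·G₀ ∝ U²` is what the `(n − m₀)`-term
  telescope sums to `∝ (c″+ΣGfr+1)·cc` (W4).

No definitions, no sorry.  Nothing asserts any stub, K3 or superconductivity. [cite: BenfattoGiulianiMastropietro2006, §2.7 (2.70)–(2.71a), §3 (3.2)–(3.8)]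
-/

noncomputable section

namespace Summit.HubbardSuperconductivity.HubbardSuperconductivity.Theorems.TorusFourierL2

set_option linter.dupNamespace false -- summit = problem name (single-conjunct summit), D-0017

open Set Finset Filter Topology Literature.MathematicalPhysics.QuantumLattice Literature.MathematicalPhysics.QuantumLattice.BandSectorCounting
open Literature.MathematicalPhysics.QuantumLattice.FermiRG Literature.Probability.LatticeModels Literature.Analysis.SpecialFunctions Literature.Analysis.Calculus
open Summit.HubbardSuperconductivity.HubbardSuperconductivity.Theorems.DispersionFlow
open Summit.HubbardSuperconductivity.HubbardSuperconductivity.Theorems.KLRegimeSplit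
open Summit.HubbardSuperconductivity.HubbardSuperconductivity.Theorems.KLProgrammeLegKernels
open Summit.HubbardSuperconductivity.HubbardSuperconductivity.Theorems.PerturbedFermiCurve
open Summit.HubbardSuperconductivity.HubbardSuperconductivity.Theorems.EngineV8
open Summit.HubbardSuperconductivity.HubbardSuperconductivity.Theorems.TwoVolumeSource
open scoped Real Nat

open Classical

set_option maxHeartbeats 1600000 in
/-- **Sharp closed-form majorant of the per-piece bound** (pure real arithmetic; ONE power of `1/Λ₁`): p3's `thinPair_rhs_majorant` with the Matsubara
count kept at `Λ₁β/π + 1 ≤ 2Λ₁β/π` under `π ≤ Λ₁β` (instead of `≤ β`), so that `(1/s₀)·(Λ₁β)` is `Λ₁`-free: the right-hand side of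
`charSumWt_thinPairDiff_flow`/`_meanFree` is `≤ M·V²·(10·d·e₀²·√K·(1/Λ₁)·G₀/x)`, `K = 524288·W_ρ·(2πΘ_c)·(96·c_N)` (p3's constant). [folklore] -/
theorem thinPair_rhs_majorant_sharp {M V : ℕ} {x Λ₁ Λ₀ β s₀ Θc Wρ A ra rbar rhomin d e₀ G₀ : ℝ} (hx : 1 ≤ x) (hΛ₁ : 0 < Λ₁) (hΛ₁1 : Λ₁ ≤ 1)
    (hΛ₀₁ : Λ₁ ≤ Λ₀) (hβ2 : 2 ≤ β) (hβM : β ≤ M) (hV : (1 : ℝ) ≤ V) (hs₀ : s₀ = Λ₁ * β / (M * π * Θc)) (hΘc : 1 ≤ Θc) (hW : 0 ≤ Wρ)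
    (hA : 0 ≤ A) (hrho : 0 < 2 * rhomin - 4 * A) (hra0 : 0 ≤ ra) (hra : ra ≤ rbar) (hd : 0 ≤ d) (hG₀ : 0 ≤ G₀) (hGΛ : G₀ / x ^ 2 ≤ Λ₁)
    (hπΛ : π ≤ Λ₁ * β) :
    x * Real.sqrt (524288 * (1 / s₀ + 1) * Wρ) *
        Real.sqrt (24 * (2 * M : ℕ) * (V : ℝ) ^ 2 *
          (2 * ((Λ₁ * β / π + 1) *
            ((Real.sqrt 2 * V * ((Λ₁ + (4 + 4 * A) * ra ^ 2) / (2 * rhomin - 4 * A)) / π + 2) * (Real.sqrt 2 * V * (2 * ra) / π + 2))))) *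
        ((d * e₀ ^ 2 / Λ₁ ^ 2 * (G₀ / x ^ 2 * (2 * (Λ₁ + G₀ / x ^ 2) + G₀ / x ^ 2))) +
          (d * e₀ ^ 2 / Λ₀ ^ 2 * (G₀ / x ^ 2 * (2 * (Λ₀ + G₀ / x ^ 2) + G₀ / x ^ 2)))) ≤
      M * (V : ℝ) ^ 2 * (10 * d * e₀ ^ 2 *
        Real.sqrt (524288 * Wρ * (2 * π * Θc) * (96 * ((Real.sqrt 2 * ((1 + (4 + 4 * A) * rbar ^ 2) / (2 * rhomin - 4 * A)) / π + 2) *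
          (2 * Real.sqrt 2 * rbar / π + 2)))) * (1 / Λ₁) * G₀ / x) := by
  have hπ := Real.pi_pos
  have hπ3 := Real.pi_gt_three
  have hx0 : 0 < x := lt_of_lt_of_le one_pos hx
  have hβ0 : 0 < β := lt_of_lt_of_le two_pos hβ2
  have hM0 : (0 : ℝ) < M := lt_of_lt_of_le hβ0 hβM
  have hV0 : (0 : ℝ) < V := lt_of_lt_of_le one_pos hV
  have hΘ0 : 0 < Θc := lt_of_lt_of_le one_pos hΘc
  have hΛ₀ : 0 < Λ₀ := lt_of_lt_of_le hΛ₁ hΛ₀₁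
  have hrbar0 : 0 ≤ rbar := hra0.trans hra
  have hY₁ : 1 ≤ 1 / Λ₁ := by rw [le_div_iff₀ hΛ₁]; linarith
  set Y₁ : ℝ := 1 / Λ₁ with hY₁def
  have hY0 : 0 ≤ Y₁ := zero_le_one.trans hY₁
  set cb : ℝ := (1 + (4 + 4 * A) * rbar ^ 2) / (2 * rhomin - 4 * A) with hcb
  set cN : ℝ := (Real.sqrt 2 * cb / π + 2) * (2 * Real.sqrt 2 * rbar / π + 2) with hcN
  have hcb0 : 0 ≤ cb := by rw [hcb]; positivity
  have hcN0 : 0 ≤ cN := by rw [hcN]; positivity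
  -- (1) the time-rate factor: `1/s₀ + 1 ≤ 2MπΘ_c·Y₁/β`
  have hs₀pos : 0 < s₀ := by rw [hs₀]; positivity
  have hs₀1 : s₀ ≤ 1 := by
    rw [hs₀, div_le_one (by positivity)]
    have h1 : Λ₁ * β ≤ 1 * (M : ℝ) := mul_le_mul hΛ₁1 hβM hβ0.le zero_le_one
    have h2 : (M : ℝ) * 1 * 1 ≤ M * π * Θc := by gcongr; linarith
    linarith
  have hinv : 1 / s₀ = M * π * Θc * Y₁ / β := by rw [hs₀, hY₁def]; field_simp
  have hW₁ : 524288 * (1 / s₀ + 1) * Wρ ≤ 524288 * Wρ * (2 * π * Θc) * (M * Y₁ / β) := by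
    have h2 : 1 / s₀ + 1 ≤ 2 * (1 / s₀) := by
      have : 1 ≤ 1 / s₀ := by rw [le_div_iff₀ hs₀pos]; linarith
      linarith
    calc 524288 * (1 / s₀ + 1) * Wρ ≤ 524288 * (2 * (1 / s₀)) * Wρ := by gcongr
      _ = 524288 * Wρ * (2 * π * Θc) * (M * Y₁ / β) := by rw [hinv]; ring
  -- (2) the count, SHARP: `N^Δ ≤ 2·(2Λ₁β/π)·c_N·V²`
  have hc₁ : (Λ₁ + (4 + 4 * A) * ra ^ 2) / (2 * rhomin - 4 * A) ≤ cb := by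
    rw [hcb]; refine div_le_div_of_nonneg_right ?_ hrho.le
    have : ra ^ 2 ≤ rbar ^ 2 := pow_le_pow_left₀ hra0 hra 2
    nlinarith only [hΛ₁1, this, hA]
  have hc₁0 : 0 ≤ (Λ₁ + (4 + 4 * A) * ra ^ 2) / (2 * rhomin - 4 * A) := by positivity
  have hP₁ : Real.sqrt 2 * V * ((Λ₁ + (4 + 4 * A) * ra ^ 2) / (2 * rhomin - 4 * A)) / π + 2 ≤ (Real.sqrt 2 * cb / π + 2) * V := by
    have h1 : Real.sqrt 2 * V * ((Λ₁ + (4 + 4 * A) * ra ^ 2) / (2 * rhomin - 4 * A)) / π ≤ Real.sqrt 2 * V * cb / π := by gcongr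
    have h2 : (2 : ℝ) ≤ 2 * V := by linarith
    calc _ ≤ Real.sqrt 2 * V * cb / π + 2 * V := add_le_add h1 h2
      _ = (Real.sqrt 2 * cb / π + 2) * V := by ring
  have hP₂ : Real.sqrt 2 * V * (2 * ra) / π + 2 ≤ (2 * Real.sqrt 2 * rbar / π + 2) * V := by
    have h1 : Real.sqrt 2 * V * (2 * ra) / π ≤ Real.sqrt 2 * V * (2 * rbar) / π := by gcongr
    have h2 : (2 : ℝ) ≤ 2 * V := by linarith
    calc _ ≤ Real.sqrt 2 * V * (2 * rbar) / π + 2 * V := add_le_add h1 h2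
      _ = (2 * Real.sqrt 2 * rbar / π + 2) * V := by ring
  have hP₁0 : 0 ≤ Real.sqrt 2 * V * ((Λ₁ + (4 + 4 * A) * ra ^ 2) / (2 * rhomin - 4 * A)) / π + 2 := by positivity
  have hP₂0 : 0 ≤ Real.sqrt 2 * V * (2 * ra) / π + 2 := by positivity
  have hLβ : Λ₁ * β / π + 1 ≤ 2 * (Λ₁ * β) / π := by
    rw [div_add_one hπ.ne', div_le_div_iff_of_pos_right hπ]
    linarith only [hπΛ]
  have hLβ0 : 0 ≤ Λ₁ * β / π + 1 := by positivity
  have hN : 2 * ((Λ₁ * β / π + 1) * ((Real.sqrt 2 * V * ((Λ₁ + (4 + 4 * A) * ra ^ 2) / (2 * rhomin - 4 * A)) / π + 2) *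
      (Real.sqrt 2 * V * (2 * ra) / π + 2))) ≤ 2 * ((2 * (Λ₁ * β) / π) * (cN * (V : ℝ) ^ 2)) := by
    have hPP : (Real.sqrt 2 * V * ((Λ₁ + (4 + 4 * A) * ra ^ 2) / (2 * rhomin - 4 * A)) / π + 2) * (Real.sqrt 2 * V * (2 * ra) / π + 2) ≤
        cN * (V : ℝ) ^ 2 := by
      calc _ ≤ ((Real.sqrt 2 * cb / π + 2) * V) * ((2 * Real.sqrt 2 * rbar / π + 2) * V) := mul_le_mul hP₁ hP₂ hP₂0 (by positivity)
        _ = cN * (V : ℝ) ^ 2 := by rw [hcN]; ring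
    have := mul_le_mul hLβ hPP (by positivity) (by positivity)
    linarith
  have hW₂ : 24 * (2 * M : ℕ) * (V : ℝ) ^ 2 * (2 * ((Λ₁ * β / π + 1) *
      ((Real.sqrt 2 * V * ((Λ₁ + (4 + 4 * A) * ra ^ 2) / (2 * rhomin - 4 * A)) / π + 2) * (Real.sqrt 2 * V * (2 * ra) / π + 2)))) ≤
      96 * cN * (2 / π) * (Λ₁ * (M * β * (V : ℝ) ^ 4)) := by
    push_cast
    have h0 : 0 ≤ 24 * (2 * (M : ℝ)) * (V : ℝ) ^ 2 := by positivity
    calc _ ≤ 24 * (2 * (M : ℝ)) * (V : ℝ) ^ 2 * (2 * ((2 * (Λ₁ * β) / π) * (cN * (V : ℝ) ^ 2))) := mul_le_mul_of_nonneg_left hN h0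
      _ = 96 * cN * (2 / π) * (Λ₁ * (M * β * (V : ℝ) ^ 4)) := by field_simp; ring
  have hW₂' : 24 * (2 * M : ℕ) * (V : ℝ) ^ 2 * (2 * ((Λ₁ * β / π + 1) *
      ((Real.sqrt 2 * V * ((Λ₁ + (4 + 4 * A) * ra ^ 2) / (2 * rhomin - 4 * A)) / π + 2) * (Real.sqrt 2 * V * (2 * ra) / π + 2)))) ≤
      96 * cN * (Λ₁ * (M * β * (V : ℝ) ^ 4)) := by
    refine hW₂.trans ?_
    have h2π : (2 : ℝ) / π ≤ 1 := by rw [div_le_one hπ]; linarith only [hπ3]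
    have hpos : 0 ≤ 96 * cN * (Λ₁ * (M * β * (V : ℝ) ^ 4)) := by positivity
    calc 96 * cN * (2 / π) * (Λ₁ * (M * β * (V : ℝ) ^ 4)) = (2 / π) * (96 * cN * (Λ₁ * (M * β * (V : ℝ) ^ 4))) := by ring
      _ ≤ 1 * (96 * cN * (Λ₁ * (M * β * (V : ℝ) ^ 4))) := mul_le_mul_of_nonneg_right h2π hpos
      _ = _ := one_mul _
  -- (3) the product of the square roots: `Y₁·Λ₁ = 1`
  set K : ℝ := 524288 * Wρ * (2 * π * Θc) * (96 * cN) with hK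
  have hK0 : 0 ≤ K := by rw [hK]; positivity
  have hsq : Real.sqrt (524288 * (1 / s₀ + 1) * Wρ) *
      Real.sqrt (24 * (2 * M : ℕ) * (V : ℝ) ^ 2 * (2 * ((Λ₁ * β / π + 1) *
        ((Real.sqrt 2 * V * ((Λ₁ + (4 + 4 * A) * ra ^ 2) / (2 * rhomin - 4 * A)) / π + 2) * (Real.sqrt 2 * V * (2 * ra) / π + 2))))) ≤
      Real.sqrt K * (M * (V : ℝ) ^ 2) := by
    have h1 := Real.sqrt_le_sqrt hW₁
    have h2 := Real.sqrt_le_sqrt hW₂'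
    have h12 := mul_le_mul h1 h2 (Real.sqrt_nonneg _) (Real.sqrt_nonneg _)
    refine h12.trans ?_
    rw [← Real.sqrt_mul (by positivity)]
    have e : 524288 * Wρ * (2 * π * Θc) * (M * Y₁ / β) * (96 * cN * (Λ₁ * (M * β * (V : ℝ) ^ 4))) = K * (M * (V : ℝ) ^ 2) ^ 2 := by
      rw [hK, hY₁def]; field_simp
    rw [e, Real.sqrt_mul hK0, Real.sqrt_sq (by positivity)]
  -- (4) the amplitude: `B₀⁽¹⁾ + B₀⁽²⁾ ≤ 10·d·e₀²·Y₁·G₀/x²`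
  have hg0 : 0 ≤ G₀ / x ^ 2 := by positivity
  have hB₁ : d * e₀ ^ 2 / Λ₁ ^ 2 * (G₀ / x ^ 2 * (2 * (Λ₁ + G₀ / x ^ 2) + G₀ / x ^ 2)) ≤ 5 * (d * e₀ ^ 2) * Y₁ * (G₀ / x ^ 2) := by
    have h5 : 2 * (Λ₁ + G₀ / x ^ 2) + G₀ / x ^ 2 ≤ 5 * Λ₁ := by linarith only [hGΛ]
    calc _ ≤ d * e₀ ^ 2 / Λ₁ ^ 2 * (G₀ / x ^ 2 * (5 * Λ₁)) := by gcongr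
      _ = 5 * (d * e₀ ^ 2) * Y₁ * (G₀ / x ^ 2) := by rw [hY₁def]; field_simp
  have hB₂ : d * e₀ ^ 2 / Λ₀ ^ 2 * (G₀ / x ^ 2 * (2 * (Λ₀ + G₀ / x ^ 2) + G₀ / x ^ 2)) ≤ 5 * (d * e₀ ^ 2) * Y₁ * (G₀ / x ^ 2) := by
    have hGΛ₀ : G₀ / x ^ 2 ≤ Λ₀ := hGΛ.trans hΛ₀₁
    have h5 : 2 * (Λ₀ + G₀ / x ^ 2) + G₀ / x ^ 2 ≤ 5 * Λ₀ := by linarith only [hGΛ₀]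
    have hY' : 1 / Λ₀ ≤ Y₁ := by rw [hY₁def]; exact one_div_le_one_div_of_le hΛ₁ hΛ₀₁
    calc _ ≤ d * e₀ ^ 2 / Λ₀ ^ 2 * (G₀ / x ^ 2 * (5 * Λ₀)) := by gcongr
      _ = 5 * (d * e₀ ^ 2) * (1 / Λ₀) * (G₀ / x ^ 2) := by field_simp
      _ ≤ 5 * (d * e₀ ^ 2) * Y₁ * (G₀ / x ^ 2) := by gcongr
  have hB : (d * e₀ ^ 2 / Λ₁ ^ 2 * (G₀ / x ^ 2 * (2 * (Λ₁ + G₀ / x ^ 2) + G₀ / x ^ 2))) +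
      (d * e₀ ^ 2 / Λ₀ ^ 2 * (G₀ / x ^ 2 * (2 * (Λ₀ + G₀ / x ^ 2) + G₀ / x ^ 2))) ≤ 10 * (d * e₀ ^ 2) * Y₁ * (G₀ / x ^ 2) := by
    linarith only [hB₁, hB₂]
  have hB0 : 0 ≤ (d * e₀ ^ 2 / Λ₁ ^ 2 * (G₀ / x ^ 2 * (2 * (Λ₁ + G₀ / x ^ 2) + G₀ / x ^ 2))) +
      (d * e₀ ^ 2 / Λ₀ ^ 2 * (G₀ / x ^ 2 * (2 * (Λ₀ + G₀ / x ^ 2) + G₀ / x ^ 2))) := by positivity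
  -- assemble
  calc _ ≤ x * (Real.sqrt K * (M * (V : ℝ) ^ 2)) * (10 * (d * e₀ ^ 2) * Y₁ * (G₀ / x ^ 2)) := by
        rw [mul_assoc x]
        exact mul_le_mul (mul_le_mul_of_nonneg_left hsq hx0.le) hB hB0 (by positivity)
    _ = M * (V : ℝ) ^ 2 * (10 * d * e₀ ^ 2 * Real.sqrt K * (1 / Λ₁) * G₀ / x) := by
        rw [hY₁def]; field_simp


set_option maxHeartbeats 4000000 in -- long statements (two chain frames, the per-piece bound) and the row/column packaging
/-- **The weighted rows/columns of one overlap-defect piece along the mean-free chain** (see the module docstring).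
[cite: BenfattoGiulianiMastropietro2006, §2.7 (2.70)–(2.71a), §3 (3.2)–(3.8)] -/
theorem rowColSumWt_overlap_sub_meanFree :
    ∃ Φ₁ Φ₂ : ℝ, 0 < Φ₁ ∧ 0 < Φ₂ ∧
      ∀ (G : GeoConsts) (P : SplitConsts) (R : RenConsts) (Qe : EngConsts) (cc : ℝ), R.WF2 → 0 < cc → cc ≤ EngineV8.klEngC₃6 P R →
      ∀ μ ∈ klWindowC, ∀ U : ℝ, 0 < U → U ≤ min (EngineV8.klEngU₀3 P R cc) (1 / (R.Gfr 3 + 1)) → ∀ c'' : ℝ, 0 ≤ c'' → c'' * U ≤ 1 →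
      ∀ β : ℝ, klBetaMin ≤ β → β ≤ Real.exp (cc / U ^ 2) →
      ∀ (L M : ℕ) [NeZero L] [NeZero M], EngineV8.klEngL₃ β U ≤ L → EngineV8.klEngM₃ β U L ≤ M →
      ∀ n : ℕ, n ≤ nScales β + 1 → IsKLRegime U cc (-(n : ℤ)) → HistP klPredsV17F2 L M G P Qe R β U μ 0 n →
        (∀ m, 1 ≤ m → m < n → FlowPieceOscAt L M c'' β U μ m) →
        ∀ (V : ℕ) [NeZero V], EngineV8.klEngL₃ β U ≤ V →
        ∀ k i : ℕ, 2 * (k + 1) + 5 ≤ i → i + 1 ≤ n →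
        (∀ X'' : SpaceTimeIdx V M × SectorLeg (sectorCount (k + 1)), ∑ X' : SpaceTimeIdx V M × SectorLeg (sectorCount k),
          ‖(sectorAnalysisMatrix V M β (klAnisoFamily V M β μ (fsub (klFlowFrameU L M β U μ (i + 1)) (symInterp L fun _ => ∑ m ∈ Ico (i + 1) n, klAngularMean (klLocalPart L M β U μ (klFlowFrameU L M β U μ m) m))) klE0 (k + 1)) * sectorSubMatrix V M β (bgmFatMultiplier V M klE0 β (nambuXiCT V μ (fsub (klFlowFrameU L M β U μ (i + 1)) (symInterp L fun _ => ∑ m ∈ Ico (i + 1) n, klAngularMean (klLocalPart L M β U μ (klFlowFrameU L M β U μ m) m)))) k) -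
             sectorAnalysisMatrix V M β (klAnisoFamily V M β μ (fsub (klFlowFrameU L M β U μ i) (symInterp L fun _ => ∑ m ∈ Ico i n, klAngularMean (klLocalPart L M β U μ (klFlowFrameU L M β U μ m) m))) klE0 (k + 1)) * sectorSubMatrix V M β (bgmFatMultiplier V M klE0 β (nambuXiCT V μ (fsub (klFlowFrameU L M β U μ i) (symInterp L fun _ => ∑ m ∈ Ico i n, klAngularMean (klLocalPart L M β U μ (klFlowFrameU L M β U μ m) m)))) k)) X'' X'‖ *
            klScaleWt V M β (k + 1) {latticeLegPos (2 * (2 * M)) X'', latticeLegPos (2 * (2 * M)) X'} ≤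
          ((M : ℝ) / β) * ((Φ₁ * (4 : ℝ) ^ (k + 1) / (4 : ℝ) ^ i + Φ₂) * ((c'' + R.Gfr 1 + R.Gfr 2 + R.Gfr 3 + 1) * U ^ 2))) ∧
        (∀ X' : SpaceTimeIdx V M × SectorLeg (sectorCount k), ∑ X'' : SpaceTimeIdx V M × SectorLeg (sectorCount (k + 1)),
          ‖(sectorAnalysisMatrix V M β (klAnisoFamily V M β μ (fsub (klFlowFrameU L M β U μ (i + 1)) (symInterp L fun _ => ∑ m ∈ Ico (i + 1) n, klAngularMean (klLocalPart L M β U μ (klFlowFrameU L M β U μ m) m))) klE0 (k + 1)) * sectorSubMatrix V M β (bgmFatMultiplier V M klE0 β (nambuXiCT V μ (fsub (klFlowFrameU L M β U μ (i + 1)) (symInterp L fun _ => ∑ m ∈ Ico (i + 1) n, klAngularMean (klLocalPart L M β U μ (klFlowFrameU L M β U μ m) m)))) k) -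
             sectorAnalysisMatrix V M β (klAnisoFamily V M β μ (fsub (klFlowFrameU L M β U μ i) (symInterp L fun _ => ∑ m ∈ Ico i n, klAngularMean (klLocalPart L M β U μ (klFlowFrameU L M β U μ m) m))) klE0 (k + 1)) * sectorSubMatrix V M β (bgmFatMultiplier V M klE0 β (nambuXiCT V μ (fsub (klFlowFrameU L M β U μ i) (symInterp L fun _ => ∑ m ∈ Ico i n, klAngularMean (klLocalPart L M β U μ (klFlowFrameU L M β U μ m) m)))) k)) X'' X'‖ *
            klScaleWt V M β (k + 1) {latticeLegPos (2 * (2 * M)) X'', latticeLegPos (2 * (2 * M)) X'} ≤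
          2 * (((M : ℝ) / β) * ((Φ₁ * (4 : ℝ) ^ (k + 1) / (4 : ℝ) ^ i + Φ₂) * ((c'' + R.Gfr 1 + R.Gfr 2 + R.Gfr 3 + 1) * U ^ 2)))) := by
  have ha : (-4 : ℝ) < -(6 / 5) := by norm_num
  have hab : (-(6 / 5) : ℝ) ≤ -(1 / 10) := by norm_num
  have hb : (-(1 / 10) : ℝ) < 0 := by norm_num
  obtain ⟨d, Ba, Q, Θc, A, hd0, -, hQ0, hΘc1, hA0, hADt, hρA, hflow⟩ := charSumWt_thinPairDiff_meanFree' ha hab hb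
  set B : BandBounds (-(6 / 5)) (-(1 / 10)) := bandBounds ha hab hb with hBdef
  have hπ := Real.pi_pos
  have hπ3 := Real.pi_gt_three
  have hDtA : 0 < B.Dtmin - 2 * A := by linarith only [hADt]
  have hrho : 0 < 2 * B.rhomin - 4 * A := by linarith only [hρA]
  have hsm := B.smax_pos
  have hDt0 := B.Dtmin_pos
  -- the absolute constants
  obtain ⟨rbar, hrbar⟩ : ∃ y : ℝ, y = (klE0 + B.smax * B.Dtmin * (3 * π / 4)) / (B.Dtmin - 2 * A) := ⟨_, rfl⟩
  obtain ⟨Wρ, hWρ⟩ : ∃ y : ℝ, y = (1 + 4 * Real.sqrt 2) ^ 2 * ((2 * Real.sqrt 2 / (1 / (4 * (Q + 1))) + 2) * (2 * Real.sqrt 2 / (1 / (4 * (Q + 1))) + 2)) +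
      (1 / (1 / (4 * (Q + 1))) + 1) ^ 2 := ⟨_, rfl⟩
  obtain ⟨K, hK⟩ : ∃ y : ℝ, y = 524288 * Wρ * (2 * π * Θc) * (96 * ((Real.sqrt 2 * ((1 + (4 + 4 * A) * rbar ^ 2) / (2 * B.rhomin - 4 * A)) / π + 2) *
      (2 * Real.sqrt 2 * rbar / π + 2))) := ⟨_, rfl⟩
  have hQ1 : 0 < Q + 1 := by linarith only [hQ0]
  have he : (0 : ℝ) < klE0 := by norm_num [klE0]
  have hWρ0 : 0 ≤ Wρ := by rw [hWρ]; positivity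
  have hrbar0 : 0 ≤ rbar := by rw [hrbar]; exact div_nonneg (by positivity) hDtA.le
  have hΘc0 : 0 < Θc := lt_of_lt_of_le one_pos hΘc1
  have hK0 : 0 ≤ K := by rw [hK]; positivity
  refine ⟨1620 * d * klE0 ^ 2 * Real.sqrt K * (π * Θc * 32) + 1, 1620 * d * klE0 ^ 2 * Real.sqrt K * (4 * (Q + 1)) + 1, by positivity, by positivity, ?_⟩
  intro G P R Qe cc hR2 hcc hcc6 μ hμ U hU hUle c'' hc0 hcU β hβmin hβc L M _ _ hL3 hM3 n hnN hreg hhist hosc V _ hV3 k i hki hin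
  -- the per-piece bound along the chain, every pair
  have hT := fun (ω₁ : Fin (sectorCount (k + 1))) (a' : Fin (sectorCount k)) =>
    hflow G P R Qe cc hR2 hcc hcc6 μ hμ U hU hUle c'' hc0 hcU β hβmin hβc L M hL3 hM3 n hnN hreg hhist hosc V hV3 k i hki hin ω₁ a'
  -- regime scalars
  have hRj : ∀ j, 0 ≤ R.Gfr j := EngineV8.gfr_nonneg_of_wf2 hR2
  have hcr : 0 ≤ R.cr := hR2.1.1
  have hβ0 : 0 < β := pos_of_klBetaMin_le hβmin
  have hβ2 : 2 ≤ β := le_trans (by norm_num [klBetaMin]) hβmin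
  have hMβ : β ≤ (M : ℝ) := EngineV8.le_of_klEngM₃_le hβmin hL3 hM3
  have hM0 : (0 : ℝ) < M := lt_of_lt_of_le hβ0 hMβ
  have hVβ : β ^ 2 ≤ (V : ℝ) := EngineV8.sq_le_of_klEngL₃_le hV3
  have hV1 : (1 : ℝ) ≤ V := le_trans (by nlinarith only [hβ2]) hVβ
  obtain ⟨hΛ0pos, hΛ1pos, -, hΛ1le1, -, -, -, -, hY01, -, -⟩ := thinPair_scale_facts k
  have hΛ01 : klScale klE0 (k + 1) ≤ klScale klE0 k := (one_div_le_one_div hΛ0pos hΛ1pos).mp hY01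
  have hU3E : U ≤ EngineV8.klEngU₀3 P R cc := hUle.trans (min_le_left _ _)
  have hU1 : U ≤ 1 := (hU3E.trans (EngineV8.klEngU₀3_le_symbolU₀ ha hab hb P hRj cc)).trans (min_le_left _ _)
  have hGU : ∀ {j : ℕ}, j < 5 → R.Gfr j * U ≤ 1 / (2 : ℝ) ^ 120 := fun hj => gfr_mul_le_of_le_klEngU₀3 P hU.le hU3E hj
  have hUd : U ≤ 1 / (2 ^ 12 * (R.Gfr 0 + R.Gfr 1 + R.cr + 1)) := hU3E.trans (klEngU₀3_le_inv_baseDoor P (hRj 0) (hRj 1) hcr cc)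
  set G₀ : ℝ := (c'' + R.Gfr 1 + R.Gfr 2 + R.Gfr 3 + 1) * U ^ 2 with hG₀def
  have hG₀0 : 0 ≤ G₀ := by rw [hG₀def]; have := hRj 1; have := hRj 2; have := hRj 3; positivity
  have hG₀2 : G₀ ≤ 2 := by
    rw [hG₀def]
    have h1 := hGU (j := 1) (by norm_num); have h2 := hGU (j := 2) (by norm_num); have h3 := hGU (j := 3) (by norm_num)
    have h120 : (1 : ℝ) / 2 ^ 120 ≤ 1 / 4 := by norm_num
    have hU12 : U ≤ 1 / 2 ^ 12 := hUd.trans (by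
      refine one_div_le_one_div_of_le (by positivity) ?_
      nlinarith only [hRj 0, hRj 1, hcr])
    have hcU2 : c'' * U ^ 2 ≤ U := by nlinarith only [hcU, hU]
    nlinarith only [h1, h2, h3, h120, hU1, hU, hU12, hcU2]
  obtain ⟨-, hx1, hGΛ, -⟩ := thinPair_depth_facts hki hG₀2
  have hx0 : (0 : ℝ) < (4 : ℝ) ^ i := by positivity
  have hRA0 : 0 ≤ (klScale klE0 (k + 1) + B.smax * B.Dtmin * (3 * sectorWidth k / 4)) / (B.Dtmin - 2 * A) := by
    have := sectorWidth_pos k; exact div_nonneg (by positivity) hDtA.le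
  have hRA : (klScale klE0 (k + 1) + B.smax * B.Dtmin * (3 * sectorWidth k / 4)) / (B.Dtmin - 2 * A) ≤ rbar := by
    rw [hrbar]; refine div_le_div_of_nonneg_right ?_ hDtA.le
    have h1 : klScale klE0 (k + 1) ≤ klE0 := klScale_le_e0 (by norm_num [klE0]) (k + 1)
    have h2 : sectorWidth k ≤ π := by
      show π / (2 : ℝ) ^ k ≤ π
      exact div_le_self hπ.le (one_le_pow₀ (by norm_num))
    nlinarith only [h1, h2, mul_pos hsm hDt0]
  -- `π ≤ Λ_{k+1}·β` (the thin scale is at most `nScales β`)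
  have hπΛ : π ≤ klScale klE0 (k + 1) * β := by
    have h1 := klth_pi_div_le_klScale_nScales hβmin
    have h2 : klScale klE0 (nScales β) ≤ klScale klE0 (k + 1) := EngineV8.klScale_le_klScale he.le (by omega)
    have := mul_le_mul_of_nonneg_right (h1.trans h2) hβ0.le
    rwa [div_mul_cancel₀ _ hβ0.ne'] at this
  -- the sharp closed-form majorant of the per-piece bound
  have hWρ0' : 0 ≤ (1 + 4 * Real.sqrt 2) ^ 2 * ((2 * Real.sqrt 2 / (1 / (4 * (Q + 1))) + 2) * (2 * Real.sqrt 2 / (1 / (4 * (Q + 1))) + 2)) +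
      (1 / (1 / (4 * (Q + 1))) + 1) ^ 2 := by positivity
  have hmaj := thinPair_rhs_majorant_sharp (M := M) (V := V) (e₀ := klE0) hx1 hΛ1pos hΛ1le1 hΛ01 hβ2 hMβ hV1 rfl hΘc1 hWρ0' hA0 hrho hRA0
    hRA hd0 hG₀0 hGΛ hπΛ
  have hT''' := fun (ω₁ : Fin (sectorCount (k + 1))) (a' : Fin (sectorCount k)) => (hT ω₁ a').trans hmaj
  rw [← hWρ, ← hK] at hT'''
  set T' : ℝ := M * (V : ℝ) ^ 2 * (10 * d * klE0 ^ 2 * Real.sqrt K * (1 / klScale klE0 (k + 1)) * G₀ / (4 : ℝ) ^ i) with hT'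
  have hT'0 : 0 ≤ T' := by rw [hT']; positivity
  -- rates and domination: `D_w := πΘ_c + Λ_{k+1}·4^i/ρ`
  set ρ : ℝ := 1 / (4 * (Q + 1)) with hρdef
  have hρpos : 0 < ρ := by rw [hρdef]; positivity
  set Dw : ℝ := π * Θc + klScale klE0 (k + 1) * (4 : ℝ) ^ i / ρ with hDwdef
  have hDw1 : 1 ≤ Dw := by
    rw [hDwdef]
    have h1 : (1 : ℝ) ≤ π * Θc := by nlinarith only [hπ3, hΘc1]
    have h2 : 0 ≤ klScale klE0 (k + 1) * (4 : ℝ) ^ i / ρ := by positivity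
    linarith only [h1, h2]
  have hdom₀ : klScale klE0 (k + 1) * β / (2 * M) ≤ Dw * (klScale klE0 (k + 1) * β / (M * π * Θc)) := by
    have h2 : 0 ≤ klScale klE0 (k + 1) * (4 : ℝ) ^ i / ρ := by positivity
    have hπΘ : π * Θc ≤ Dw := by rw [hDwdef]; linarith only [h2]
    have hs0 : 0 ≤ klScale klE0 (k + 1) * β / (M * π * Θc) := by positivity
    calc klScale klE0 (k + 1) * β / (2 * M) ≤ klScale klE0 (k + 1) * β / M :=
          div_le_div_of_nonneg_left (by positivity) hM0 (by linarith only [hM0])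
      _ = (π * Θc) * (klScale klE0 (k + 1) * β / (M * π * Θc)) := by field_simp
      _ ≤ Dw * (klScale klE0 (k + 1) * β / (M * π * Θc)) := mul_le_mul_of_nonneg_right hπΘ hs0
  have hdom₁ : klScale klE0 (k + 1) ≤ Dw * (ρ / (4 : ℝ) ^ i) := by
    have h1 : 0 ≤ π * Θc := by positivity
    have hge : klScale klE0 (k + 1) * (4 : ℝ) ^ i / ρ ≤ Dw := by rw [hDwdef]; linarith only [h1]
    calc klScale klE0 (k + 1) = (klScale klE0 (k + 1) * (4 : ℝ) ^ i / ρ) * (ρ / (4 : ℝ) ^ i) := by field_simp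
      _ ≤ Dw * (ρ / (4 : ℝ) ^ i) := mul_le_mul_of_nonneg_right hge (by positivity)
  -- the ε of `klReanalysis` and the target arithmetic
  have hε : 0 < imagTimeWeight β M := by unfold imagTimeWeight; positivity
  set Am : Matrix (SpaceTimeIdx V M × SectorLeg (sectorCount (k + 1))) (SpaceTimeIdx V M × SectorLeg (sectorCount k)) ℂ :=
    sectorAnalysisMatrix V M β (klAnisoFamily V M β μ (fsub (klFlowFrameU L M β U μ (i + 1)) (symInterp L fun _ => ∑ m ∈ Ico (i + 1) n, klAngularMean (klLocalPart L M β U μ (klFlowFrameU L M β U μ m) m))) klE0 (k + 1)) * sectorSubMatrix V M β (bgmFatMultiplier V M klE0 β (nambuXiCT V μ (fsub (klFlowFrameU L M β U μ (i + 1)) (symInterp L fun _ => ∑ m ∈ Ico (i + 1) n, klAngularMean (klLocalPart L M β U μ (klFlowFrameU L M β U μ m) m)))) k) -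
      sectorAnalysisMatrix V M β (klAnisoFamily V M β μ (fsub (klFlowFrameU L M β U μ i) (symInterp L fun _ => ∑ m ∈ Ico i n, klAngularMean (klLocalPart L M β U μ (klFlowFrameU L M β U μ m) m))) klE0 (k + 1)) * sectorSubMatrix V M β (bgmFatMultiplier V M klE0 β (nambuXiCT V μ (fsub (klFlowFrameU L M β U μ i) (symInterp L fun _ => ∑ m ∈ Ico i n, klAngularMean (klLocalPart L M β U μ (klFlowFrameU L M β U μ m) m)))) k)
    with hAdef
  have hsmul : klReanalysis V M β μ (fsub (klFlowFrameU L M β U μ (i + 1)) (symInterp L fun _ => ∑ m ∈ Ico (i + 1) n, klAngularMean (klLocalPart L M β U μ (klFlowFrameU L M β U μ m) m))) k - klReanalysis V M β μ (fsub (klFlowFrameU L M β U μ i) (symInterp L fun _ => ∑ m ∈ Ico i n, klAngularMean (klLocalPart L M β U μ (klFlowFrameU L M β U μ m) m))) k = ((imagTimeWeight β M : ℝ) : ℂ) • Am := by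
    rw [hAdef, klReanalysis, klReanalysis, Matrix.smul_mul, Matrix.smul_mul, smul_sub]
  have hentry : ∀ X'' X', ‖(klReanalysis V M β μ (fsub (klFlowFrameU L M β U μ (i + 1)) (symInterp L fun _ => ∑ m ∈ Ico (i + 1) n, klAngularMean (klLocalPart L M β U μ (klFlowFrameU L M β U μ m) m))) k - klReanalysis V M β μ (fsub (klFlowFrameU L M β U μ i) (symInterp L fun _ => ∑ m ∈ Ico i n, klAngularMean (klLocalPart L M β U μ (klFlowFrameU L M β U μ m) m))) k) X'' X'‖ = imagTimeWeight β M * ‖Am X'' X'‖ := by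
    intro X'' X'
    rw [hsmul, Matrix.smul_apply, norm_smul, Complex.norm_real, Real.norm_eq_abs, abs_of_pos hε]
  have hΛval : klScale klE0 (k + 1) = (1 / 32) * ((4 : ℝ) ^ (k + 1))⁻¹ := by rw [klScale, klE0]
  have hfin : imagTimeWeight β M * (((27 : ℕ) + (27 : ℕ)) * (3 * (Dw * T') / (β * (V : ℝ) ^ 2))) ≤
      imagTimeWeight β M * (((M : ℝ) / β) * (((1620 * d * klE0 ^ 2 * Real.sqrt K * (π * Θc * 32) + 1) * (4 : ℝ) ^ (k + 1) / (4 : ℝ) ^ i +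
        (1620 * d * klE0 ^ 2 * Real.sqrt K * (4 * (Q + 1)) + 1)) * G₀)) := by
    refine mul_le_mul_of_nonneg_left ?_ hε.le
    have hV0 : (0 : ℝ) < V := lt_of_lt_of_le one_pos hV1
    have e : ((27 : ℕ) + (27 : ℕ)) * (3 * (Dw * T') / (β * (V : ℝ) ^ 2)) =
        ((M : ℝ) / β) * ((1620 * d * klE0 ^ 2 * Real.sqrt K * (π * Θc * 32) * (4 : ℝ) ^ (k + 1) / (4 : ℝ) ^ i +
          1620 * d * klE0 ^ 2 * Real.sqrt K * (4 * (Q + 1))) * G₀) := by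
      rw [hT', hDwdef, hρdef, hΛval]; push_cast; field_simp; ring
    rw [e]
    have hMβ0 : 0 ≤ (M : ℝ) / β := by positivity
    refine mul_le_mul_of_nonneg_left (mul_le_mul_of_nonneg_right ?_ hG₀0) hMβ0
    have h4 : 0 ≤ (4 : ℝ) ^ (k + 1) / (4 : ℝ) ^ i := by positivity
    have e1 : (1620 * d * klE0 ^ 2 * Real.sqrt K * (π * Θc * 32) + 1) * (4 : ℝ) ^ (k + 1) / (4 : ℝ) ^ i =
        1620 * d * klE0 ^ 2 * Real.sqrt K * (π * Θc * 32) * (4 : ℝ) ^ (k + 1) / (4 : ℝ) ^ i + (4 : ℝ) ^ (k + 1) / (4 : ℝ) ^ i := by ring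
    rw [e1]; linarith only [h4]
  have hrw : ∀ X'' X', ‖(klReanalysis V M β μ (fsub (klFlowFrameU L M β U μ (i + 1)) (symInterp L fun _ => ∑ m ∈ Ico (i + 1) n, klAngularMean (klLocalPart L M β U μ (klFlowFrameU L M β U μ m) m))) k - klReanalysis V M β μ (fsub (klFlowFrameU L M β U μ i) (symInterp L fun _ => ∑ m ∈ Ico i n, klAngularMean (klLocalPart L M β U μ (klFlowFrameU L M β U μ m) m))) k) X'' X'‖ *
      klScaleWt V M β (k + 1) {latticeLegPos (2 * (2 * M)) X'', latticeLegPos (2 * (2 * M)) X'} =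
      imagTimeWeight β M * (‖Am X'' X'‖ * klScaleWt V M β (k + 1) {latticeLegPos (2 * (2 * M)) X'', latticeLegPos (2 * (2 * M)) X'}) :=
    fun X'' X' => by rw [hentry X'' X', mul_assoc]
  refine ⟨fun X'' => ?_, fun X' => ?_⟩
  · have hrow := (rowSumWt_klReanalysis_sub_le_of_rates (L := V) (M := M) hβ0 μ (fsub (klFlowFrameU L M β U μ i) (symInterp L fun _ => ∑ m ∈ Ico i n, klAngularMean (klLocalPart L M β U μ (klFlowFrameU L M β U μ m) m))) (fsub (klFlowFrameU L M β U μ (i + 1)) (symInterp L fun _ => ∑ m ∈ Ico (i + 1) n, klAngularMean (klLocalPart L M β U μ (klFlowFrameU L M β U μ m) m))) k hT'0 hDw1 hdom₀ hdom₁ hT''' X'').trans hfin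
    rw [Finset.sum_congr rfl (fun X' _ => hrw X'' X'), ← Finset.mul_sum] at hrow
    exact le_of_mul_le_mul_left hrow hε
  · have hcol := colSumWt_klReanalysis_sub_le_of_rates (L := V) (M := M) hβ0 μ (fsub (klFlowFrameU L M β U μ i) (symInterp L fun _ => ∑ m ∈ Ico i n, klAngularMean (klLocalPart L M β U μ (klFlowFrameU L M β U μ m) m))) (fsub (klFlowFrameU L M β U μ (i + 1)) (symInterp L fun _ => ∑ m ∈ Ico (i + 1) n, klAngularMean (klLocalPart L M β U μ (klFlowFrameU L M β U μ m) m))) k hT'0 hDw1 hdom₀ hdom₁ hT''' X'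
    have e : (((27 * 2 ^ (k + 1 - k) : ℕ) : ℝ) + ((27 * 2 ^ (k + 1 - k) : ℕ) : ℝ)) = 2 * (((27 : ℕ) : ℝ) + ((27 : ℕ) : ℝ)) := by
      rw [show k + 1 - k = 1 by omega]; push_cast; ring
    rw [e, mul_assoc (2 : ℝ), ← mul_assoc (imagTimeWeight β M) 2, mul_comm (imagTimeWeight β M) 2, mul_assoc (2 : ℝ)] at hcol
    have hcol' := hcol.trans (mul_le_mul_of_nonneg_left hfin (by norm_num))
    rw [Finset.sum_congr rfl (fun X'' _ => hrw X'' X'), ← Finset.mul_sum] at hcol'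
    have hcol'' := hcol'.trans_eq (mul_left_comm (2 : ℝ) (imagTimeWeight β M) _)
    exact le_of_mul_le_mul_left hcol'' hε

end Summit.HubbardSuperconductivity.HubbardSuperconductivity.Theorems.TorusFourierL2

end
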